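import Summits.RiemannHypothesis.RiemannHypothesis.Theorems.HandoffDodgerSlabFourProfile
import HarnessLib

/-!
# HANDOFF — SIXTH SLAB (2): the COUNTING profile-control constants at `y = 16`, `N₁ = 21`, `η` generic in a horizon floor `Tm` (rh-explicit, W-P(P2) crux 19172 residue, seat prove-2 gen14; ATTEMPT-24 §3)

RH-FREE. HONEST FRAMING: nothing here bears on the truth of RH; part (2) of the discharge of the hypotheses of
`HandoffDodgerExplicitWindowCountingFT.dodger_witness_explicit_window_counting_ft` (ATTEMPT-16 Lemma B3/D1 profile control) on the sixth
slab `640 ≤ q < 1015` at the CONSTANT schedule `y = 16`, `N₁ = 21` (dodger-p2's `HandoffDodgerSlabFiveProfile` re-constanted). With `V = T₀²`,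
`AU = T₀/(25π) + s/2 + (T+¼)k/W` and the sizes of part (1) (`10700 ≤ T′`, `T₀ ≤ 1.017T′`, `T′² ≤ W`, `k′ ≤ 1.105T′`, `T′³/30.1 ≤ pL`,
`s ≤ 11.27`): `x := 21V/pL ≤ 654/T′`, `AU ≤ 0.01295T′ + 6.75`, hence **`η ≤ e^{u₀} − 1`** for any `u₀` with
`(0.01295·Tm + 6.75)·427716 ≤ u₀·Tm·(Tm − 654)`, `Tm ≤ T′` (per sub-slab floor `Tm = 16.8(A−1)` in the assembly); `λU ≤ 0.423`, `ρ₁ ≤ 0.738`,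
`3τ₁ + τ₂ ≤ 0.02`, `ρ₂U ≤ 1/2500 ≤ e^{−2}`, `τ₂U ≤ 10⁻⁴`, `N₁ + 1 ≤ pL/(2V)`; so `κ ≥ 2 − e^{u₀} − 0.02` (`profile_constants_slabSix`).
No `sorry`, standard axioms, no definitions.

References: this track (ATTEMPT-16 §3 (B3), §5 (D1), ATTEMPT-19 §8, ATTEMPT-23 §7, ATTEMPT-24 §3; HOME/rh-explicit-dodger-p2/DODGER-STAGE2-PLAN.md §2).
-/

set_option linter.dupNamespace false

noncomputable section

open Real

namespace Summit.RiemannHypothesis.RiemannHypothesis.Theorems.Handoff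

/-- `30 ≤ pL/(2V)` on the sixth slab (`V = T₀² ≤ 1.0343T²`, `pL ≥ T³/30.1`, `T ≥ 10700`). [this track, DODGER-STAGE2-PLAN §2] -/
theorem N_le_slabSix {T T₀ pL : ℝ} (hT : 10700 ≤ T) (hT₀0 : 0 < T₀) (hT₀T : T₀ ≤ 1017 / 1000 * T) (hpL : T ^ 3 / 30.1 ≤ pL) :
    (30 : ℝ) ≤ pL / (2 * T₀ ^ 2) := by
  have hT0 : 0 < T := by linarith
  rw [le_div_iff₀ (by positivity)]
  have h4 : T ^ 3 ≤ 30.1 * pL := by rw [div_le_iff₀ (by norm_num)] at hpL; linarith only [hpL]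
  have hV : T₀ ^ 2 ≤ (1017 / 1000 * T) ^ 2 := pow_le_pow_left₀ hT₀0.le hT₀T 2
  nlinarith only [h4, hV, hT, hT0]

/-- `x = 21V/pL ≤ 654/T` on the sixth slab. [this track, DODGER-STAGE2-PLAN §2] -/
theorem x_le_slabSix {T T₀ pL : ℝ} (hT : 10700 ≤ T) (hT₀0 : 0 < T₀) (hT₀T : T₀ ≤ 1017 / 1000 * T) (hpL : T ^ 3 / 30.1 ≤ pL) :
    T₀ ^ 2 * (21 : ℝ) / pL ≤ 654 / T := by
  have hT0 : 0 < T := by linarith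
  have hpL0 : 0 < pL := lt_of_lt_of_le (by positivity) hpL
  rw [div_le_div_iff₀ hpL0 hT0]
  have h4 : T ^ 3 ≤ 30.1 * pL := by rw [div_le_iff₀ (by norm_num)] at hpL; linarith only [hpL]
  have hV : T₀ ^ 2 ≤ (1017 / 1000 * T) ^ 2 := pow_le_pow_left₀ hT₀0.le hT₀T 2
  nlinarith only [h4, hV, hT0, hpL0]

/-- `AU = T₀/(25π) + s/2 + (T+¼)k/W ≤ 0.01295T + 6.75` on the sixth slab. [this track, DODGER-STAGE2-PLAN §2] -/
theorem AU_le_slabSix {T T₀ s k W AU : ℝ} (hT : 10700 ≤ T) (hT₀T : T₀ ≤ 1017 / 1000 * T) (hs : s ≤ 11.27)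
    (hk : k ≤ 1.105 * T) (hW1 : T ^ 2 ≤ W)
    (hAU : AU = T₀ / (25 * π) + s / 2 + (T + 1 / 4) * k / W) : AU ≤ 0.01295 * T + 6.75 := by
  have hT0 : 0 < T := by linarith
  have hW0 : 0 < W := lt_of_lt_of_le (by positivity) hW1
  have hπ : 3.1415 < π := Real.pi_gt_d4
  rw [hAU]
  have h1 : T₀ / (25 * π) ≤ 0.01295 * T := by
    rw [div_le_iff₀ (by positivity)]; nlinarith only [hT₀T, hπ, hT0]
  have h3 : (T + 1 / 4) * k / W ≤ 1.106 := by
    rw [div_le_iff₀ hW0]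
    have : (T + 1 / 4) * k ≤ (T + 1 / 4) * (1.105 * T) := mul_le_mul_of_nonneg_left hk (by linarith)
    nlinarith only [this, hW1, hT, hT0]
  linarith only [h1, h3, hs, hT0]

/-- **`η ≤ e^{u₀} − 1`** on the sixth slab, GENERIC in a horizon floor `Tm ≤ T`: `AU·x²/(1−x) ≤ u₀` whenever
`(0.01295·Tm + 6.75)·427716 ≤ u₀·Tm·(Tm − 654)` (`x ≤ 654/T`, `654² = 427716`). [this track, DODGER-STAGE2-PLAN §2; ATTEMPT-24 §3] -/
theorem eta_le_slabSix {T Tm AU x ηU u₀ : ℝ} (hT : 10700 ≤ T) (hTm : 10700 ≤ Tm) (hTmT : Tm ≤ T)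
    (hAUle : AU ≤ 0.01295 * T + 6.75) (hx0 : 0 ≤ x) (hxle : x ≤ 654 / T)
    (hηU : ηU = Real.exp (AU * x ^ 2 / (1 - x)) - 1)
    (hu₀ : (0.01295 * Tm + 6.75) * 427716 ≤ u₀ * (Tm * (Tm - 654))) : ηU ≤ Real.exp u₀ - 1 := by
  have hT0 : 0 < T := by linarith
  have hTm0 : 0 < Tm := by linarith
  have hxm : 654 / T ≤ 654 / Tm := div_le_div_of_nonneg_left (by norm_num) hTm0 hTmT
  have hxm1 : 654 / Tm ≤ 0.062 := by rw [div_le_iff₀ hTm0]; linarith only [hTm]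
  have hx1 : x < 1 := by linarith only [hxle, hxm, hxm1]
  rw [hηU]
  have hg : AU * x ^ 2 / (1 - x) ≤ u₀ := by
    -- numerator: `AU·x² ≤ (0.01295T + 6.75)(654/T)² ≤ (0.01295Tm + 6.75)·427716/Tm²`
    have hn1 : AU * x ^ 2 ≤ (0.01295 * T + 6.75) * (654 / T) ^ 2 :=
      mul_le_mul hAUle (pow_le_pow_left₀ hx0 hxle 2) (sq_nonneg x) (by positivity)
    have hn2 : (0.01295 * T + 6.75) * (654 / T) ^ 2 ≤ (0.01295 * Tm + 6.75) * 427716 / Tm ^ 2 := by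
      rw [div_pow, ← mul_div_assoc, div_le_div_iff₀ (by positivity) (by positivity)]
      have h1 : (654 : ℝ) ^ 2 ≤ 427716 := by norm_num
      -- `(aT + c)·Tm² ≤ (aTm + c)·T²` for `Tm ≤ T`
      have h2 : (0.01295 * T + 6.75) * Tm ^ 2 ≤ (0.01295 * Tm + 6.75) * T ^ 2 := by
        have hd : 0 ≤ T - Tm := by linarith only [hTmT]
        nlinarith only [hd, hTm0, hT0, mul_nonneg (mul_nonneg hd hTm0.le) hT0.le]
      calc (0.01295 * T + 6.75) * 654 ^ 2 * Tm ^ 2 = ((0.01295 * T + 6.75) * Tm ^ 2) * 654 ^ 2 := by ring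
        _ ≤ ((0.01295 * Tm + 6.75) * T ^ 2) * 427716 := mul_le_mul h2 h1 (by positivity) (by positivity)
        _ = (0.01295 * Tm + 6.75) * 427716 * T ^ 2 := by ring
    have hden : 1 - 654 / Tm ≤ 1 - x := by linarith only [hxle, hxm]
    have hden0 : 0 < 1 - 654 / Tm := by linarith only [hxm1]
    calc AU * x ^ 2 / (1 - x) ≤ ((0.01295 * Tm + 6.75) * 427716 / Tm ^ 2) / (1 - x) :=
          div_le_div_of_nonneg_right (hn1.trans hn2) (by linarith only [hx1])
      _ ≤ ((0.01295 * Tm + 6.75) * 427716 / Tm ^ 2) / (1 - 654 / Tm) :=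
          div_le_div_of_nonneg_left (by positivity) hden0 hden
      _ = (0.01295 * Tm + 6.75) * 427716 / (Tm * (Tm - 654)) := by
          field_simp
      _ ≤ u₀ := by
          have h873 : 0 < Tm - 654 := by linarith only [hTm]
          rw [div_le_iff₀ (mul_pos hTm0 h873)]
          exact hu₀
  linarith only [Real.exp_le_exp.2 hg]

/-- `λU = AU·V/pL ≤ 0.423` on the sixth slab. [this track, DODGER-STAGE2-PLAN §2] -/
theorem lam_le_slabSix {T T₀ pL AU lamU : ℝ} (hT : 10700 ≤ T) (hT₀0 : 0 < T₀) (hT₀T : T₀ ≤ 1017 / 1000 * T)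
    (hpL : T ^ 3 / 30.1 ≤ pL) (hAUle : AU ≤ 0.01295 * T + 6.75) (hlamU : lamU = AU * T₀ ^ 2 / pL) :
    lamU ≤ 0.423 := by
  have hT0 : 0 < T := by linarith
  have hpL0 : 0 < pL := lt_of_lt_of_le (by positivity) hpL
  rw [hlamU, div_le_iff₀ hpL0]
  have h4 : T ^ 3 ≤ 30.1 * pL := by rw [div_le_iff₀ (by norm_num)] at hpL; linarith only [hpL]
  have hV : T₀ ^ 2 ≤ (1017 / 1000 * T) ^ 2 := pow_le_pow_left₀ hT₀0.le hT₀T 2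
  have h1 : AU * T₀ ^ 2 ≤ (0.01295 * T + 6.75) * (1017 / 1000 * T) ^ 2 := mul_le_mul hAUle hV (by positivity) (by positivity)
  nlinarith only [h1, h4, hT, hT0]

/-- `ρ₁ ≤ 0.738` at `y = 16`, `N₁ = 21`, `λU ≤ 0.423`. [this track, DODGER-STAGE2-PLAN §2] -/
theorem rho1_le_slabSix {lamU ρ1 y : ℝ} {N₁ : ℕ} (hlam : lamU ≤ 0.423) (hy : y = 16) (hN₁ : N₁ = 21)
    (hρ1 : ρ1 = Real.exp (3 + lamU) * (4 * y ^ 2) / (4 * ((N₁ : ℝ) + 1) ^ 3)) : ρ1 ≤ 0.738 := by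
  have hexp : Real.exp (3 + lamU) ≤ 30.667 := by
    rw [Real.exp_add]
    have h3 : Real.exp 3 ≤ 20.0856 := by
      have e : Real.exp 1 ^ 3 = Real.exp 3 := by exact_mod_cast Real.exp_one_pow 3
      rw [← e]
      have := Real.exp_one_lt_d9
      have h := pow_le_pow_left₀ (Real.exp_pos 1).le this.le 3
      exact h.trans (by norm_num)
    have h4 : Real.exp lamU ≤ 1.5268 := by
      refine (Real.exp_le_exp.2 hlam).trans ?_
      have := Real.exp_bound' (x := (0.423 : ℝ)) (by norm_num) (by norm_num) (n := 4) (by norm_num)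
      simp only [Finset.sum_range_succ, Finset.sum_range_zero, Nat.factorial] at this
      norm_num at this
      linarith
    calc Real.exp 3 * Real.exp lamU ≤ 20.0856 * 1.5268 := mul_le_mul h3 h4 (Real.exp_pos _).le (by norm_num)
      _ ≤ 30.667 := by norm_num
  rw [hρ1, hy, hN₁, div_le_iff₀ (by positivity)]
  push_cast
  nlinarith only [hexp]

/-- `τ₁ ≤ 0.0049` from `ρ₁ ≤ 0.738` and `N₁ = 21`. [this track, DODGER-STAGE2-PLAN §2] -/
theorem tau1_le_slabSix {ρ1 τ1 : ℝ} {N₁ : ℕ} (hρ1ge : 0 ≤ ρ1) (hρ1le : ρ1 ≤ 0.738) (hN₁ : N₁ = 21)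
    (hτ1 : τ1 = ρ1 ^ (N₁ + 1) / (1 - ρ1)) : τ1 ≤ 49 / 10000 := by
  rw [hτ1, hN₁, div_le_iff₀ (by linarith only [hρ1le])]
  have h2 : ρ1 ^ (21 + 1) ≤ (0.738 : ℝ) ^ (21 + 1) := pow_le_pow_left₀ hρ1ge hρ1le _
  have h3 : (0.738 : ℝ) ^ (21 + 1) ≤ 126 / 100000 := by norm_num
  nlinarith only [h2, h3, hρ1le]

/-- `ρ₂U = 8e²V³y²/pL³ ≤ 1/2500` at `y = 16` on the sixth slab. [this track, DODGER-STAGE2-PLAN §2] -/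
theorem rho2_le_slabSix {T T₀ pL ρ2U y : ℝ} (hT : 10700 ≤ T) (hT₀0 : 0 < T₀) (hT₀T : T₀ ≤ 1017 / 1000 * T)
    (hpL : T ^ 3 / 30.1 ≤ pL) (hy : y = 16) (hρ2U : ρ2U = 8 * Real.exp 2 * (T₀ ^ 2) ^ 3 * y ^ 2 / pL ^ 3) :
    ρ2U ≤ 1 / 2500 := by
  have hT0 : 0 < T := by linarith
  have hpL0 : 0 < pL := lt_of_lt_of_le (by positivity) hpL
  rw [hρ2U, hy, div_le_iff₀ (by positivity)]
  have hV : T₀ ^ 2 ≤ 1.0343 * T ^ 2 := by nlinarith only [pow_le_pow_left₀ hT₀0.le hT₀T 2]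
  have hW3' : (T₀ ^ 2) ^ 3 ≤ (1.0343 * T ^ 2) ^ 3 := pow_le_pow_left₀ (by positivity) hV 3
  have hp3 : (T ^ 3 / 30.1) ^ 3 ≤ pL ^ 3 := pow_le_pow_left₀ (by positivity) hpL 3
  have e2 := exp_numerics.1
  have h1 : 8 * Real.exp 2 * (T₀ ^ 2) ^ 3 * (16 : ℝ) ^ 2 ≤ 8 * 7.39 * (1.0343 * T ^ 2) ^ 3 * 16 ^ 2 := by
    have := mul_le_mul e2.le hW3' (by positivity) (by norm_num)
    nlinarith only [this]
  have h2 : 8 * 7.39 * (1.0343 * T ^ 2) ^ 3 * (16 : ℝ) ^ 2 ≤ 1 / 2500 * (T ^ 3 / 30.1) ^ 3 := by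
    have e1 : (T ^ 3 / 30.1) ^ 3 = T ^ 6 * T ^ 3 / 30.1 ^ 3 := by ring
    have e3 : 8 * 7.39 * (1.0343 * T ^ 2) ^ 3 * (16 : ℝ) ^ 2 = 8 * 7.39 * 1.0343 ^ 3 * 16 ^ 2 * T ^ 6 := by ring
    rw [e1, e3]
    have hT3 : (10700 : ℝ) ^ 3 ≤ T ^ 3 := pow_le_pow_left₀ (by norm_num) hT 3
    have hT6 : (0 : ℝ) ≤ T ^ 6 := by positivity
    have key : 8 * 7.39 * 1.0343 ^ 3 * 16 ^ 2 * ((30.1 : ℝ) ^ 3 * 2500) ≤ T ^ 3 := le_trans (by norm_num) hT3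
    have hk := mul_le_mul_of_nonneg_left key hT6
    rw [show 1 / 2500 * (T ^ 6 * T ^ 3 / 30.1 ^ 3) = T ^ 6 * T ^ 3 / ((30.1 : ℝ) ^ 3 * 2500) by ring]
    rw [le_div_iff₀ (by norm_num)]
    nlinarith only [hk]
  nlinarith only [h1, h2, hp3]

/-- `τ₂U ≤ 10⁻⁴` on the sixth slab (`τ₂U = exp(pL/(2V)(1 + log ρ₂U) + AU/2)/(1 − ρ₂U)`, `ρ₂U ≤ 1/2500`, `pL/(2V) ≥ T/62.3`,
`AU ≤ 0.01295T + 6.75`). [this track, DODGER-STAGE2-PLAN §2; ATTEMPT-24 §3] -/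
theorem tau2_le_slabSix {T T₀ pL AU ρ2U τ2U : ℝ} (hT : 10700 ≤ T) (hT₀0 : 0 < T₀) (hT₀T : T₀ ≤ 1017 / 1000 * T)
    (hpL : T ^ 3 / 30.1 ≤ pL) (hAUle : AU ≤ 0.01295 * T + 6.75)
    (hρ2ge : 0 < ρ2U) (hρ2le : ρ2U ≤ 1 / 2500)
    (hτ2U : τ2U = Real.exp (pL / (2 * T₀ ^ 2) * (1 + Real.log ρ2U) + AU / 2) / (1 - ρ2U)) :
    τ2U ≤ 1 / 10000 := by
  have hT0 : 0 < T := by linarith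
  have hpL0 : 0 < pL := lt_of_lt_of_le (by positivity) hpL
  rw [hτ2U, div_le_iff₀ (by linarith only [hρ2le])]
  have hlog : Real.log ρ2U ≤ -7.5 := by
    rw [Real.log_le_iff_le_exp hρ2ge]
    refine hρ2le.trans ?_
    rw [Real.exp_neg, le_inv_comm₀ (by norm_num) (Real.exp_pos _)]
    have h8 : Real.exp 7.5 = Real.exp 4 * Real.exp 4 * Real.exp (-(1 / 2)) := by rw [← Real.exp_add, ← Real.exp_add]; norm_num
    have hh : Real.exp (-(1 / 2 : ℝ)) ≤ 0.61 := by
      have hs := Real.sum_le_exp_of_nonneg (show (0:ℝ) ≤ 1 / 2 by norm_num) 4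
      simp only [Finset.sum_range_succ, Finset.sum_range_zero, Nat.factorial, Nat.succ_eq_add_one] at hs
      norm_num at hs
      rw [Real.exp_neg, inv_le_comm₀ (Real.exp_pos _) (by norm_num)]
      linarith
    rw [h8]; nlinarith only [exp_numerics.2.2.1, Real.exp_pos 4, hh, Real.exp_pos (-(1/2 : ℝ)), mul_pos (Real.exp_pos 4) (Real.exp_pos 4)]
  have hpW : 30 ≤ pL / (2 * T₀ ^ 2) := N_le_slabSix hT hT₀0 hT₀T hpL
  have hpV : T / 62.3 ≤ pL / (2 * T₀ ^ 2) := by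
    rw [div_le_div_iff₀ (by norm_num) (by positivity)]
    have h4 : T ^ 3 ≤ 30.1 * pL := by rw [div_le_iff₀ (by norm_num)] at hpL; linarith only [hpL]
    have hV : T₀ ^ 2 ≤ (1017 / 1000 * T) ^ 2 := pow_le_pow_left₀ hT₀0.le hT₀T 2
    nlinarith only [h4, hV, hT0, hpL0]
  have hX : pL / (2 * T₀ ^ 2) * (1 + Real.log ρ2U) + AU / 2 ≤ -10 := by
    have h1 : 1 + Real.log ρ2U ≤ -6.5 := by linarith only [hlog]
    have h2 : pL / (2 * T₀ ^ 2) * (1 + Real.log ρ2U) ≤ -(T / 10) := by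
      have hP0 : 0 ≤ pL / (2 * T₀ ^ 2) := by positivity
      have h3 : pL / (2 * T₀ ^ 2) * (1 + Real.log ρ2U) ≤ pL / (2 * T₀ ^ 2) * (-6.5) :=
        mul_le_mul_of_nonneg_left h1 hP0
      have hpV' : T ≤ pL / (2 * T₀ ^ 2) * 62.3 := (div_le_iff₀ (by norm_num : (0:ℝ) < 62.3)).1 hpV
      linarith only [h3, hpV', hT]
    linarith only [h2, hAUle, hT]
  have hE : Real.exp (pL / (2 * T₀ ^ 2) * (1 + Real.log ρ2U) + AU / 2) ≤ 1 / 20000 := by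
    refine (Real.exp_le_exp.2 hX).trans ?_
    rw [Real.exp_neg, inv_le_comm₀ (Real.exp_pos _) (by norm_num)]
    have h10 : Real.exp 10 = Real.exp 4 * Real.exp 4 * Real.exp 2 := by rw [← Real.exp_add, ← Real.exp_add]; norm_num
    rw [h10]; norm_num; nlinarith only [exp_numerics.2.2.2, exp_numerics.2.1, Real.exp_pos 2, Real.exp_pos 4]
  nlinarith only [hE, hρ2le, Real.exp_pos (pL / (2 * T₀ ^ 2) * (1 + Real.log ρ2U) + AU / 2)]

/-- **Part (2) of the sixth-slab discharge: the COUNTING profile-control constants at `y = 16`, `N₁ = 21`, `η` generic.**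
`N₁+1 ≤ pL/(2V)`, `ρ₁ < 1`, `ρ₂U ≤ e^{−2}`, and `2 − e^{u₀} − 0.02 ≤ κ` for any `u₀` with `(0.01295·Tm + 6.75)·427716 ≤ u₀·Tm·(Tm − 654)`,
`10700 ≤ Tm ≤ T`. [this track, DODGER-STAGE2-PLAN §2; ATTEMPT-24 §3] -/
theorem profile_constants_slabSix {b T T₀ k pL W s y V AU lamU ρ1 ρ2U ηU τ1 τ2U κ Tm u₀ : ℝ} {N₁ : ℕ}
    (hb1 : b ≤ 347 / 100) (hT : 10700 ≤ T) (hT₀0 : 0 < T₀) (hT₀T : T₀ ≤ 1017 / 1000 * T) (hTm : 10700 ≤ Tm) (hTmT : Tm ≤ T)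
    (hW1 : T ^ 2 ≤ W) (hk0 : 2 ≤ k) (hk : k ≤ 0.3184 * b * T) (hpL : T ^ 3 / 30.1 ≤ pL) (hs0 : 0 ≤ s) (hs : s ≤ 11.27)
    (hy : y = 16) (hN₁ : N₁ = 21) (hV : V = T₀ ^ 2)
    (hAU : AU = T₀ / (25 * π) + s / 2 + (T + 1 / 4) * k / W)
    (hηU : ηU = Real.exp (AU * (V * (N₁ : ℝ) / pL) ^ 2 / (1 - V * (N₁ : ℝ) / pL)) - 1)
    (hlamU : lamU = AU * V / pL)
    (hρ1 : ρ1 = Real.exp (3 + lamU) * (4 * y ^ 2) / (4 * ((N₁ : ℝ) + 1) ^ 3))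
    (hρ2U : ρ2U = 8 * Real.exp 2 * V ^ 3 * y ^ 2 / pL ^ 3)
    (hτ1 : τ1 = ρ1 ^ (N₁ + 1) / (1 - ρ1))
    (hτ2U : τ2U = Real.exp (pL / (2 * V) * (1 + Real.log ρ2U) + AU / 2) / (1 - ρ2U))
    (hκ : κ = 1 - ηU - 3 * τ1 - τ2U)
    (hu₀ : (0.01295 * Tm + 6.75) * 427716 ≤ u₀ * (Tm * (Tm - 654))) :
    (N₁ : ℝ) + 1 ≤ pL / (2 * V) ∧ ρ1 < 1 ∧ ρ2U ≤ Real.exp (-2) ∧ 2 - Real.exp u₀ - 2 / 100 ≤ κ := by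
  have hT0 : 0 < T := by linarith
  have hW0 : 0 < W := lt_of_lt_of_le (by positivity) hW1
  have hk00 : 0 ≤ k := by linarith only [hk0]
  have hk' : k ≤ 1.105 * T := by nlinarith only [hk, hb1, hT0]
  have hpL0 : 0 < pL := lt_of_lt_of_le (by positivity) hpL
  have hAU0 : 0 ≤ AU := by rw [hAU]; positivity
  have hAUle := AU_le_slabSix hT hT₀T hs hk' hW1 hAU
  subst hV
  have hN : (N₁ : ℝ) + 1 ≤ pL / (2 * T₀ ^ 2) := by
    rw [hN₁]; push_cast
    have := N_le_slabSix hT hT₀0 hT₀T hpL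
    linarith only [this]
  have hlam0 : 0 ≤ lamU := by rw [hlamU]; positivity
  have hlamle := lam_le_slabSix hT hT₀0 hT₀T hpL hAUle hlamU
  have hρ1le := rho1_le_slabSix hlamle hy hN₁ hρ1
  have hρ1ge : 0 ≤ ρ1 := by rw [hρ1]; positivity
  have hτ1le := tau1_le_slabSix hρ1ge hρ1le hN₁ hτ1
  have hρ2le := rho2_le_slabSix hT hT₀0 hT₀T hpL hy hρ2U
  have hρ2ge : 0 < ρ2U := by rw [hρ2U, hy]; positivity
  have hρ2e : ρ2U ≤ Real.exp (-2) := by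
    refine hρ2le.trans ?_
    rw [Real.exp_neg, le_inv_comm₀ (by norm_num) (Real.exp_pos _)]
    have := exp_numerics.1; norm_num; linarith only [this]
  have hτ2le := tau2_le_slabSix hT hT₀0 hT₀T hpL hAUle hρ2ge hρ2le hτ2U
  -- `η ≤ e^{u₀} − 1` with `x = 21V/pL`
  have hx0 : 0 ≤ T₀ ^ 2 * (N₁ : ℝ) / pL := by positivity
  have hxle : T₀ ^ 2 * (N₁ : ℝ) / pL ≤ 654 / T := by
    rw [hN₁]; push_cast; exact x_le_slabSix hT hT₀0 hT₀T hpL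
  have hηle := eta_le_slabSix hT hTm hTmT hAUle hx0 hxle hηU hu₀
  refine ⟨hN, by linarith only [hρ1le], hρ2e, ?_⟩
  rw [hκ]; linarith only [hηle, hτ1le, hτ2le]

end Summit.RiemannHypothesis.RiemannHypothesis.Theorems.Handoff

end
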